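import Summits.QuantumFields.BalabanUV.Beta.GAN24.InsertionWordVolumeLimit
import Summits.QuantumFields.BalabanUV.T4Continuum.Support.AbelianCovariantLaplacian
import Literature.MathematicalPhysics.QuantumFieldTheory.Balaban1983to89.Beta.RemainderKernelBlockAveraging

/-!
# `BalabanUV.Beta.GAN24.CouplingLetterStencil` — binder row G-an2-4 ∕ (CONV-C), route R7 «TWO CURRENCIES», PART 236: THE COUPLING LETTERS
# `A = P(V₁) + P(V₂)ᴴ + diag W` — FIRST ORDER, ADJOINT PLACEMENT AND ZEROTH ORDER AT ONCE — ACT ON THE LEFT INDEX OF THE FINE PROPAGATOR BY A THREE-POINT STENCIL: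
# fine window decay of `A·G`, pair entry limits of `A_t·G_t` modulo EL₁ of the backgrounds, `PerturbationLaws` and the conjugated (H-bd) letter of `A`.

WHY (census «first-order MODEL framing», g64 HANDOFF (α)).  PARTs 147–163 put every background-derivative diagram of the effective form in the β-cell's currency for the FIRST-ORDER
MODEL `Δ_a + uP(V)`, `P(V) = Σ_μ diag(V_μ)∇_μ` (NE2's `Pmodel`).  Bałaban's covariant vector Laplacian is NOT of that form: NE2's tier-A identity
`AbelianCovariantLaplacian.covPert_eq` reads `Δ^{U} − Δ^{1} = P(−w) + P(−w)ᴴ + diag z` EXACTLY (`w = η⁻¹(U − 1)`, `z` the zeroth-order field) — an ADJOINT placement `P(V)ᴴ = Σ_μ ∇_μᴴdiag(V̄_μ)`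
and a ZEROTH-ORDER letter `diag W` appear next to the first-order one.  This file supplies, for the whole class of COUPLING LETTERS `A = P(V₁) + P(V₂)ᴴ + diag W` (`V₁, V₂`
`LipschitzBackground (α, β)`, `W` a `BoundedBackground (α′, β′)`), the three letter facts on which PART 159 ∕ 160 ∕ 161 run: (c) the stencil, the fine window decay of `A·G` and EL₂ of
`A_t·G_t` (PART 151's §1–§2 for `P(V)`); (a) `PerturbationLaws` with `κ = (2d(α+β) + α′)Cst`, `e₂ = (C₂ + C₂ᴴ + Cst²β′)L^{−k}` (NE2's three laws added); (b) the conjugated (H-bd) letter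
`‖c(A)c(Δ_a⁻¹)‖ ≤ d·αG₂ + d·e^{|κ|}(αG₂ + βγ_w⁻¹) + α′γ_w⁻¹` at the canonical weights (`CTConjugatedHbd`'s three pieces).  PART 237 feeds them to the word INPUTS, PART 238 to the
diagrams and the Taylor coefficients along `u ↦ Δ_a + u·A`; the INSTANCE `A = Δ^{U} − Δ^{1}` is then ONE `rw [covPert_eq]` (unit b2b-balaban-gan24-p3, gen 65; v1)

NOT IN PRINT; OUR PROOF ([folklore] bookkeeping BY NAME over PART 151 (`Pmodel_mul_apply`, `fdiff_mul_apply`, `norm_Pmodel_mul_apply_le`, `tendsto_Pmodel_mul_pair`,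
`l1_windowMap_add_unitVec_ge`), PART 142 (`l1_windowMap_sub_castT_ge`), NE2's `FirstOrderBackgroundModel` (`LipschitzBackground`, `Pmodel`, `perturbationLaws_firstOrder`),
`FirstOrderAdjointModel` (`conjTranspose_firstOrder`, `conjTranspose_fdiff_eq`, `perturbationLaws_firstOrderAdjoint`, `C2adj`), `PerturbationAlgebra` (`BoundedBackground`,
`perturbationLaws_zerothOrder`, `perturbationLaws_add`, `perturbationLaws_mono`), `BalabanBlockPoincare` (`transl_mul_apply`, `conjTranspose_transl`, `shiftM_eq_transl`),
`CTConjugatedHbd` (`opNorm_conjMat_firstOrder_le`, `opNorm_conjMat_firstOrderH_le`, `opNorm_conjMat_diagonal_mul_inv_le`), `InsertionChainDecay.hPc_firstOrder`'s pattern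
(`abs_rho_fineStep_le`); [Balaban1985BackgroundPropagators] (3.3) p. 390 and [Balaban1987RG1] (1.21)–(1.22) p. 264 LOCATE the shapes; nothing printed is a hypothesis).
HONEST FRAMING (cell contract, verbatim): «discharging `BetaPertH` makes Bałaban's UV stability UNCONDITIONAL — a real constructive-QFT result; it is NOT the
continuum limit and NOT the Clay problem.»  HONEST DEPENDENCY (verbatim): «continuum YM on T⁴ ⇐ BetaPertH ∧ nine spine estimates (0/9 proved); BetaPertH ⇐
(D1) ∧ (D4) ∧ CAP+tail; G-an2-4 gates asym, D1 and NE2/3/4.»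

WHAT THIS FILE PROVES (0 sorry, 0 `def`; `n_k = L^k`; `τ_μ⁻¹(x, f) = (x − e_μ, f)`; EL₁ ∕ EL₂ = convergence at every fine integer point ∕ pair along `t → ∞`):
* §1 `conjTranspose_shiftM_mul_apply` (`(S_μᴴX)(i, j) = X(τ_μ⁻¹i, j)`), `conjTranspose_fdiff_mul_apply` (`(∇_μᴴX)(i,j) = n·(X(τ_μ⁻¹i, j) − X(i, j))`), **`conjTranspose_Pmodel_mul_apply`**
  (`(P(V)ᴴG)(i,j) = Σ_μ n_k(V̄_μ(τ_μ⁻¹i)G(τ_μ⁻¹i, j) − V̄_μ(i)G(i, j))`), **`couplingLetter_mul_apply`**.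
* §2 `l1_windowMap_sub_unitVec_ge` (b01's `l1_single`), **`norm_conjTranspose_Pmodel_mul_apply_le`**, **`norm_diagonal_mul_apply_le`**, **`norm_couplingLetter_mul_apply_le`** (a fine-window-decaying `G`
  gives a fine-window-decaying `A·G`, constant `(2dα·n_k(e^{3δ}+1) + α′)·C`, same rate).
* §3 **`tendsto_conjTranspose_Pmodel_mul_pair`**, **`tendsto_diagonal_mul_pair`**, **`tendsto_couplingLetter_mul_pair`** (any `side t → ∞`: EL₁ of `V₁,V₂,W` at level `k` + EL₂ of `G_t` ⟹
  EL₂ of `A_t·G_t`).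
* §4 **`perturbationLaws_couplingLetter`** (`κ = 2d(α+β)Cst + α′Cst`, `e₂ k = (C2model + C2adj + Cst·β′·Cst)·L^{−k}`).
* §5 **`hPc_couplingLetter`** — the conjugated (H-bd) of `A` at the canonical weights `ρ_{k,y}` from a conjugation-defect bound `J` of `Δ_a^{(k)}`.
WHAT IT DOES NOT DO: the words ∕ diagrams ∕ Taylor coefficients (PARTs 237–238); non-abelian colour letters (NE2's `ColourCovariantLaplacian`, another index type); Bałaban's `−∂P∂*`,
`aQ(U)*Q(U)` parts (not covariantised in NE2's tier A either).  SUPPLIER work; NEVER «G-an2-4 closed»; NOT (CONV-C), NOT D1, NOT `BetaPertH`, NOT continuum, NOT Clay.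
Records: `HOME/b2b-balaban-gan24-p3/gen65/README.md`.
-/

noncomputable section

open scoped BigOperators ComplexConjugate Matrix Matrix.Norms.L2Operator
open Filter Topology

namespace Summit.QuantumFields.BalabanUV.Beta.GAN24.CouplingLetterStencil

open Literature.MathematicalPhysics.QuantumFieldTheory.Balaban1983to89
open Literature.MathematicalPhysics.QuantumFieldTheory.Balaban1983to89.B5Prop11Plancherel (Tor fine fdiff shiftM unitVec Cst Cst_nonneg)
open Literature.MathematicalPhysics.QuantumFieldTheory.Balaban1983to89.B5G183RateUnitTower (lev)
open Literature.MathematicalPhysics.QuantumFieldTheory.Balaban1983to89.B12Sec2to5 (l1)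
open Literature.MathematicalPhysics.QuantumFieldTheory.Balaban1983to89.Beta (Site windowMap)
open Literature.MathematicalPhysics.QuantumFieldTheory.Balaban1983to89.Beta.FreeLegDictionary (cubic)
open Literature.MathematicalPhysics.QuantumFieldTheory.Balaban1983to89.Beta.VectorTails (castT castT_add castT_neg castT_single)
open Literature.MathematicalPhysics.QuantumFieldTheory.Balaban1983to89.Beta.RemainderKernelBlockAveraging (l1_single)
open Summit.QuantumFields.BalabanUV.T4Continuum
open Summit.QuantumFields.BalabanUV.T4Continuum.BalabanAveragedTowerUnit (idx one_le_lev' cast_lev')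
open Summit.QuantumFields.BalabanUV.T4Continuum.BalabanBlockPoincare (transl transl_mul_apply shiftM_eq_transl)
open Summit.QuantumFields.BalabanUV.T4Continuum.BlockPairingGeometry (tau conjTranspose_transl)
open Summit.QuantumFields.BalabanUV.T4Continuum.BackgroundResolventTower (PerturbationLaws)
open Summit.QuantumFields.BalabanUV.T4Continuum.KingPairingPlantedLaw (calDalev JpcT)
open Summit.QuantumFields.BalabanUV.T4Continuum.FirstOrderBackgroundModel (LipschitzBackground Pmodel firstOrder C2model perturbationLaws_firstOrder)
open Summit.QuantumFields.BalabanUV.T4Continuum.FirstOrderAdjointModel (conjTranspose_firstOrder conjTranspose_fdiff_eq perturbationLaws_firstOrderAdjoint C2adj)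
open Summit.QuantumFields.BalabanUV.T4Continuum.PerturbationAlgebra (BoundedBackground perturbationLaws_zerothOrder perturbationLaws_add perturbationLaws_mono)
open Summit.QuantumFields.BalabanUV.T4Continuum.CTWeightedCoercivity (conjMat conjMat_add ConjDefect)
open Summit.QuantumFields.BalabanUV.T4Continuum.CTKingTowerWeights (rho abs_rho_fineStep_le)
open Summit.QuantumFields.BalabanUV.T4Continuum.CTConjugatedHbd (G2 opNorm_conjMat_firstOrder_le opNorm_conjMat_firstOrderH_le opNorm_conjMat_diagonal_mul_inv_le)
open Summit.QuantumFields.BalabanUV.T4Continuum.DirichletRegionTower (gamD)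
open Summit.QuantumFields.BalabanUV.Beta.GAN24.DiagramVolumeLimitPairs (l1_windowMap_sub_castT_ge)
open Summit.QuantumFields.BalabanUV.Beta.GAN24.PerturbedPropagatorVolumeLimit (Pmodel_mul_apply fdiff_mul_apply norm_Pmodel_mul_apply_le tendsto_Pmodel_mul_pair)

variable {d : ℕ} (L : ℕ) [NeZero L]

/-! ## §1 The adjoint placement and the zeroth-order letter act on the left index by a stencil -/

section Stencil

variable (N : Fin d → ℕ) [hN : ∀ μ, NeZero (N μ)]

/-- `(S_νᴴ·X)(i, j) = X((i₁ − e_ν, i₂), j)` (`S_νᴴ = T_{−e_ν}`). [folklore] -/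
theorem conjTranspose_shiftM_mul_apply {β : Type*} (ν : Fin d) (X : Matrix (Tor N × Fin d) β ℂ) (i : Tor N × Fin d) (b : β) :
    ((shiftM N ν)ᴴ * X) i b = X (i.1 - unitVec N ν, i.2) b := by
  rw [shiftM_eq_transl, conjTranspose_transl, transl_mul_apply, ← sub_eq_add_neg]

end Stencil

section Level

variable (n : ℕ) [NeZero n] (M : Fin d → ℕ) [hM : ∀ μ, NeZero (M μ)]

/-- `(∇_νᴴ·X)(i, j) = n·(X((i₁ − e_ν, i₂), j) − X(i, j))` for the natural lattice factor (`∇ᴴ = −Sᴴ∇`). [folklore] -/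
theorem conjTranspose_fdiff_mul_apply (ν : Fin d) (X : Matrix (Tor (fine n M) × Fin d) (Tor (fine n M) × Fin d) ℂ) (i j : Tor (fine n M) × Fin d) :
    ((fdiff (fine n M) ((n : ℕ) : ℂ) ν)ᴴ * X) i j = ((n : ℕ) : ℂ) * (X (i.1 - unitVec (fine n M) ν, i.2) j - X i j) := by
  rw [conjTranspose_fdiff_eq, Matrix.neg_mul, Matrix.mul_assoc, Matrix.neg_apply, conjTranspose_shiftM_mul_apply, fdiff_mul_apply]
  simp only [sub_add_cancel, Prod.mk.eta]
  ring

end Level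

section Model

variable (M : Fin d → ℕ) [hM : ∀ μ, NeZero (M μ)]

/-- **`conjTranspose_Pmodel_mul_apply` — THE ADJOINT PLACEMENT ACTS ON THE LEFT INDEX BY A TWO-POINT STENCIL**:
`(P(V)^{(k)ᴴ}·G)(i, j) = Σ_μ n_k·(V̄^{(k)}_μ((i₁ − e_μ, i₂))·G((i₁ − e_μ, i₂), j) − V̄^{(k)}_μ(i)·G(i, j))`. [folklore] -/
theorem conjTranspose_Pmodel_mul_apply (V : (k : ℕ) → Fin d → (idx L M k → ℂ)) (k : ℕ) (G : Matrix (idx L M k) (idx L M k) ℂ) (i j : idx L M k) :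
    ((Pmodel L M V k)ᴴ * G) i j = ∑ μ, ((lev L k : ℕ) : ℂ) *
      (star (V k μ (i.1 - unitVec (fine (lev L k) M) μ, i.2)) * G (i.1 - unitVec (fine (lev L k) M) μ, i.2) j - star (V k μ i) * G i j) := by
  unfold Pmodel
  rw [conjTranspose_firstOrder, Finset.sum_mul, Matrix.sum_apply]
  refine Finset.sum_congr rfl fun μ _ => ?_
  rw [Matrix.mul_assoc, conjTranspose_fdiff_mul_apply, Matrix.diagonal_mul, Matrix.diagonal_mul]
  rfl

/-- **`couplingLetter_mul_apply` — THE COUPLING LETTER `A = P(V₁) + P(V₂)ᴴ + diag W` ACTS ON THE LEFT INDEX BY A THREE-POINT STENCIL** `{i, i + e_μ, i − e_μ}`. [folklore] -/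
theorem couplingLetter_mul_apply (V₁ V₂ : (k : ℕ) → Fin d → (idx L M k → ℂ)) (W : (k : ℕ) → (idx L M k → ℂ)) (k : ℕ) (G : Matrix (idx L M k) (idx L M k) ℂ) (i j : idx L M k) :
    ((Pmodel L M V₁ k + (Pmodel L M V₂ k)ᴴ + Matrix.diagonal (W k)) * G) i j
      = (∑ μ, V₁ k μ i * (((lev L k : ℕ) : ℂ) * (G (i.1 + unitVec (fine (lev L k) M) μ, i.2) j - G i j)))
        + (∑ μ, ((lev L k : ℕ) : ℂ) * (star (V₂ k μ (i.1 - unitVec (fine (lev L k) M) μ, i.2)) * G (i.1 - unitVec (fine (lev L k) M) μ, i.2) j - star (V₂ k μ i) * G i j))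
        + W k i * G i j := by
  rw [Matrix.add_mul, Matrix.add_mul, Matrix.add_apply, Matrix.add_apply, Pmodel_mul_apply, conjTranspose_Pmodel_mul_apply, Matrix.diagonal_mul]

end Model

/-! ## §2 Fine window decay of `A·G` -/

section Window

omit [NeZero L] in
/-- **`l1_windowMap_sub_unitVec_ge`**: `|windowMap v|₁ − 3 ≤ |windowMap (v − e_μ)|₁` on the cubic torus `(ℤ∕s)^d` (PART 142's `l1_windowMap_sub_castT_ge` at `z = e_μ`). [folklore] -/
theorem l1_windowMap_sub_unitVec_ge (s : ℕ) [NeZero s] (v : Site d s) (μ : Fin d) :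
    l1 (windowMap d s v) - 3 ≤ l1 (windowMap d s (v - unitVec (cubic d s) μ)) := by
  have h := l1_windowMap_sub_castT_ge s v (Pi.single μ (1 : ℤ))
  have e : v - castT (cubic d s) (Pi.single μ (1 : ℤ)) = v - unitVec (cubic d s) μ := by
    rw [castT_single]; rfl
  rw [l1_single, mul_one, e] at h
  exact h

/-- **`norm_conjTranspose_Pmodel_mul_apply_le` — `P(V)ᴴ·G` DECAYS LIKE `G` IN THE FINE WINDOW** [folklore]: on the fine torus of the cubic volume `(ℤ∕s)^d` at level `k`, if
`‖G((w,g),(y,h))‖ ≤ C·e^{−δ|windowMap(w − y)|₁}` (`C, δ ≥ 0`) and `V` has size `≤ α` (`LipschitzBackground`, only the size is used), then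
`‖(P(V)^{(k)ᴴ}·G)((w,g),(y,h))‖ ≤ d·(α·n_k·((e^{3δ} + 1)·C))·e^{−δ|windowMap(w − y)|₁}`. -/
theorem norm_conjTranspose_Pmodel_mul_apply_le (s : ℕ) [NeZero s] {V : (k : ℕ) → Fin d → (idx L (cubic d s) k → ℂ)} {α β : ℝ} (hV : LipschitzBackground L (cubic d s) V α β)
    (k : ℕ) {G : Matrix (idx L (cubic d s) k) (idx L (cubic d s) k) ℂ} {C δ : ℝ} (hC : 0 ≤ C) (hδ : 0 ≤ δ)
    (hG : ∀ (w : Site d (lev L k * s)) (g : Fin d) (y : Site d (lev L k * s)) (h : Fin d), ‖G (w, g) (y, h)‖ ≤ C * Real.exp (-δ * l1 (windowMap d (lev L k * s) (w - y))))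
    (w : Site d (lev L k * s)) (g : Fin d) (y : Site d (lev L k * s)) (h : Fin d) :
    ‖((Pmodel L (cubic d s) V k)ᴴ * G) (w, g) (y, h)‖ ≤ d * (α * lev L k * ((Real.exp (3 * δ) + 1) * C)) * Real.exp (-δ * l1 (windowMap d (lev L k * s) (w - y))) := by
  rw [conjTranspose_Pmodel_mul_apply]
  have hα0 : 0 ≤ α := hV.nonneg.1
  calc ‖∑ μ, ((lev L k : ℕ) : ℂ) * (star (V k μ (w - unitVec (fine (lev L k) (cubic d s)) μ, g)) * G (w - unitVec (fine (lev L k) (cubic d s)) μ, g) (y, h)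
          - star (V k μ (w, g)) * G (w, g) (y, h))‖
      ≤ ∑ μ, ‖((lev L k : ℕ) : ℂ) * (star (V k μ (w - unitVec (fine (lev L k) (cubic d s)) μ, g)) * G (w - unitVec (fine (lev L k) (cubic d s)) μ, g) (y, h)
          - star (V k μ (w, g)) * G (w, g) (y, h))‖ := norm_sum_le _ _
    _ ≤ ∑ _μ : Fin d, α * lev L k * ((Real.exp (3 * δ) + 1) * C) * Real.exp (-δ * l1 (windowMap d (lev L k * s) (w - y))) := by
        refine Finset.sum_le_sum fun μ _ => ?_
        rw [norm_mul, Complex.norm_natCast]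
        have h1 : ‖star (V k μ (w - unitVec (fine (lev L k) (cubic d s)) μ, g))‖ ≤ α := by rw [norm_star]; exact hV.bound k μ _
        have h1' : ‖star (V k μ (w, g))‖ ≤ α := by rw [norm_star]; exact hV.bound k μ _
        have ha := hG (w - unitVec (fine (lev L k) (cubic d s)) μ) g y h
        have hb := hG w g y h
        have e1 : w - unitVec (fine (lev L k) (cubic d s)) μ - y = (w - y) - unitVec (cubic d (lev L k * s)) μ := by
          rw [sub_right_comm]
        have hwin := l1_windowMap_sub_unitVec_ge (lev L k * s) (w - y) μ
        have hexp : Real.exp (-δ * l1 (windowMap d (lev L k * s) (w - unitVec (fine (lev L k) (cubic d s)) μ - y)))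
            ≤ Real.exp (3 * δ) * Real.exp (-δ * l1 (windowMap d (lev L k * s) (w - y))) := by
          rw [e1, ← Real.exp_add]
          exact Real.exp_le_exp.mpr (by nlinarith)
        have h2 : ‖star (V k μ (w - unitVec (fine (lev L k) (cubic d s)) μ, g)) * G (w - unitVec (fine (lev L k) (cubic d s)) μ, g) (y, h) - star (V k μ (w, g)) * G (w, g) (y, h)‖
            ≤ α * (((Real.exp (3 * δ) + 1) * C) * Real.exp (-δ * l1 (windowMap d (lev L k * s) (w - y)))) := by
          refine (norm_sub_le _ _).trans ?_
          rw [norm_mul, norm_mul]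
          have hE := Real.exp_pos (-δ * l1 (windowMap d (lev L k * s) (w - y)))
          calc ‖star (V k μ (w - unitVec (fine (lev L k) (cubic d s)) μ, g))‖ * ‖G (w - unitVec (fine (lev L k) (cubic d s)) μ, g) (y, h)‖ + ‖star (V k μ (w, g))‖ * ‖G (w, g) (y, h)‖
              ≤ α * (C * (Real.exp (3 * δ) * Real.exp (-δ * l1 (windowMap d (lev L k * s) (w - y))))) + α * (C * Real.exp (-δ * l1 (windowMap d (lev L k * s) (w - y)))) :=
                add_le_add (mul_le_mul h1 (ha.trans (mul_le_mul_of_nonneg_left hexp hC)) (norm_nonneg _) hα0)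
                  (mul_le_mul h1' hb (norm_nonneg _) hα0)
            _ = α * (((Real.exp (3 * δ) + 1) * C) * Real.exp (-δ * l1 (windowMap d (lev L k * s) (w - y)))) := by ring
        calc (lev L k : ℝ) * ‖star (V k μ (w - unitVec (fine (lev L k) (cubic d s)) μ, g)) * G (w - unitVec (fine (lev L k) (cubic d s)) μ, g) (y, h)
              - star (V k μ (w, g)) * G (w, g) (y, h)‖
            ≤ (lev L k : ℝ) * (α * (((Real.exp (3 * δ) + 1) * C) * Real.exp (-δ * l1 (windowMap d (lev L k * s) (w - y))))) :=
              mul_le_mul_of_nonneg_left h2 (Nat.cast_nonneg _)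
          _ = α * lev L k * ((Real.exp (3 * δ) + 1) * C) * Real.exp (-δ * l1 (windowMap d (lev L k * s) (w - y))) := by ring
    _ = d * (α * lev L k * ((Real.exp (3 * δ) + 1) * C)) * Real.exp (-δ * l1 (windowMap d (lev L k * s) (w - y))) := by
        rw [Finset.sum_const, Finset.card_univ, Fintype.card_fin, nsmul_eq_mul]; ring

/-- **`norm_diagonal_mul_apply_le` — `diag W·G` DECAYS LIKE `G`** (constant `α′·C`, same rate; only the size `|W| ≤ α′` is used). [folklore] -/
theorem norm_diagonal_mul_apply_le (s : ℕ) [NeZero s] {W : (k : ℕ) → (idx L (cubic d s) k → ℂ)} {α' β' : ℝ} (hW : BoundedBackground L (cubic d s) W α' β')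
    (k : ℕ) {G : Matrix (idx L (cubic d s) k) (idx L (cubic d s) k) ℂ} {C δ : ℝ}
    (hG : ∀ (w : Site d (lev L k * s)) (g : Fin d) (y : Site d (lev L k * s)) (h : Fin d), ‖G (w, g) (y, h)‖ ≤ C * Real.exp (-δ * l1 (windowMap d (lev L k * s) (w - y))))
    (w : Site d (lev L k * s)) (g : Fin d) (y : Site d (lev L k * s)) (h : Fin d) :
    ‖(Matrix.diagonal (W k) * G) (w, g) (y, h)‖ ≤ α' * C * Real.exp (-δ * l1 (windowMap d (lev L k * s) (w - y))) := by
  rw [Matrix.diagonal_mul, norm_mul, mul_assoc]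
  exact mul_le_mul (hW.bound k _) (hG w g y h) (norm_nonneg _) hW.nonneg.1

/-- **`norm_couplingLetter_mul_apply_le` — `A·G` DECAYS LIKE `G` IN THE FINE WINDOW** for the coupling letter `A = P(V₁) + P(V₂)ᴴ + diag W` (`V₁, V₂` of size `≤ α`, `W` of size `≤ α′`):
constant `(2d·(α·n_k·(e^{3δ}+1)) + α′)·C`, same rate. [folklore] -/
theorem norm_couplingLetter_mul_apply_le (s : ℕ) [NeZero s] {V₁ V₂ : (k : ℕ) → Fin d → (idx L (cubic d s) k → ℂ)} {W : (k : ℕ) → (idx L (cubic d s) k → ℂ)} {α β α' β' : ℝ}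
    (hV₁ : LipschitzBackground L (cubic d s) V₁ α β) (hV₂ : LipschitzBackground L (cubic d s) V₂ α β) (hW : BoundedBackground L (cubic d s) W α' β')
    (k : ℕ) {G : Matrix (idx L (cubic d s) k) (idx L (cubic d s) k) ℂ} {C δ : ℝ} (hC : 0 ≤ C) (hδ : 0 ≤ δ)
    (hG : ∀ (w : Site d (lev L k * s)) (g : Fin d) (y : Site d (lev L k * s)) (h : Fin d), ‖G (w, g) (y, h)‖ ≤ C * Real.exp (-δ * l1 (windowMap d (lev L k * s) (w - y))))
    (w : Site d (lev L k * s)) (g : Fin d) (y : Site d (lev L k * s)) (h : Fin d) :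
    ‖((Pmodel L (cubic d s) V₁ k + (Pmodel L (cubic d s) V₂ k)ᴴ + Matrix.diagonal (W k)) * G) (w, g) (y, h)‖
      ≤ (2 * (d * (α * lev L k * ((Real.exp (3 * δ) + 1) * C))) + α' * C) * Real.exp (-δ * l1 (windowMap d (lev L k * s) (w - y))) := by
  rw [Matrix.add_mul, Matrix.add_mul, Matrix.add_apply, Matrix.add_apply]
  have h1 := norm_Pmodel_mul_apply_le L s hV₁ k hC hδ hG w g y h
  have h2 := norm_conjTranspose_Pmodel_mul_apply_le L s hV₂ k hC hδ hG w g y h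
  have h3 := norm_diagonal_mul_apply_le L s hW k hG w g y h
  calc _ ≤ ‖(Pmodel L (cubic d s) V₁ k * G) (w, g) (y, h)‖ + ‖((Pmodel L (cubic d s) V₂ k)ᴴ * G) (w, g) (y, h)‖ + ‖(Matrix.diagonal (W k) * G) (w, g) (y, h)‖ :=
        norm_add₃_le
    _ ≤ _ := by nlinarith [h1, h2, h3, Real.exp_pos (-δ * l1 (windowMap d (lev L k * s) (w - y)))]

end Window

/-! ## §3 EL₂ of `A_t·G_t` from EL₁ of the backgrounds and EL₂ of `G_t`, along any volume sequence -/

section AnyVolume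

variable {side : ℕ → ℕ}

/-- **`tendsto_conjTranspose_Pmodel_mul_pair`** [folklore]: along `side t → ∞`, at level `k`: EL₁ of `V_t` and EL₂ of `G_t` ⟹ EL₂ of `P(V_t)^{(k)ᴴ}·G_t` — by §1's stencil, the reading of
`z − e_μ` being `ẑ_t − e_μ`, and `star` being continuous. -/
theorem tendsto_conjTranspose_Pmodel_mul_pair [∀ t, NeZero (side t)] (k : ℕ) (V : (t : ℕ) → (k : ℕ) → Fin d → (idx L (cubic d (side t)) k → ℂ))
    (hV : ∀ (μ f : Fin d) (z : Fin d → ℤ), ∃ s : ℂ, Tendsto (fun t => V t k μ (castT (cubic d (lev L k * side t)) z, f)) atTop (𝓝 s))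
    {G : (t : ℕ) → Matrix (idx L (cubic d (side t)) k) (idx L (cubic d (side t)) k) ℂ}
    (hG : ∀ (f g : Fin d) (z z' : Fin d → ℤ), ∃ s : ℂ, Tendsto (fun t => G t (castT (cubic d (lev L k * side t)) z, f) (castT (cubic d (lev L k * side t)) z', g)) atTop (𝓝 s))
    (f g : Fin d) (z z' : Fin d → ℤ) :
    ∃ s : ℂ, Tendsto (fun t => ((Pmodel L (cubic d (side t)) (V t) k)ᴴ * G t) (castT (cubic d (lev L k * side t)) z, f) (castT (cubic d (lev L k * side t)) z', g)) atTop (𝓝 s) := by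
  choose sV hsV using hV
  choose sG hsG using hG
  refine ⟨∑ μ, ((lev L k : ℕ) : ℂ) * (star (sV μ f (z - Pi.single μ 1)) * sG f g (z - Pi.single μ 1) z' - star (sV μ f z) * sG f g z z'), ?_⟩
  have e : ∀ t, ((Pmodel L (cubic d (side t)) (V t) k)ᴴ * G t) (castT (cubic d (lev L k * side t)) z, f) (castT (cubic d (lev L k * side t)) z', g)
      = ∑ μ, ((lev L k : ℕ) : ℂ) * (star (V t k μ (castT (cubic d (lev L k * side t)) (z - Pi.single μ 1), f))
          * G t (castT (cubic d (lev L k * side t)) (z - Pi.single μ 1), f) (castT (cubic d (lev L k * side t)) z', g)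
          - star (V t k μ (castT (cubic d (lev L k * side t)) z, f)) * G t (castT (cubic d (lev L k * side t)) z, f) (castT (cubic d (lev L k * side t)) z', g)) := by
    intro t
    rw [conjTranspose_Pmodel_mul_apply]
    refine Finset.sum_congr rfl fun μ _ => ?_
    rw [sub_eq_add_neg z, castT_add, castT_neg, castT_single, ← sub_eq_add_neg]
    rfl
  simp only [e]
  exact tendsto_finsetSum _ fun μ _ =>
    ((((hsV μ f (z - Pi.single μ 1)).star).mul (hsG f g (z - Pi.single μ 1) z')).sub (((hsV μ f z).star).mul (hsG f g z z'))).const_mul _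

/-- **`tendsto_diagonal_mul_pair`** [folklore]: EL₁ of `W_t` at level `k` and EL₂ of `G_t` ⟹ EL₂ of `diag(W_t^{(k)})·G_t`. -/
theorem tendsto_diagonal_mul_pair [∀ t, NeZero (side t)] (k : ℕ) (W : (t : ℕ) → (k : ℕ) → (idx L (cubic d (side t)) k → ℂ))
    (hW : ∀ (f : Fin d) (z : Fin d → ℤ), ∃ s : ℂ, Tendsto (fun t => W t k (castT (cubic d (lev L k * side t)) z, f)) atTop (𝓝 s))
    {G : (t : ℕ) → Matrix (idx L (cubic d (side t)) k) (idx L (cubic d (side t)) k) ℂ}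
    (hG : ∀ (f g : Fin d) (z z' : Fin d → ℤ), ∃ s : ℂ, Tendsto (fun t => G t (castT (cubic d (lev L k * side t)) z, f) (castT (cubic d (lev L k * side t)) z', g)) atTop (𝓝 s))
    (f g : Fin d) (z z' : Fin d → ℤ) :
    ∃ s : ℂ, Tendsto (fun t => (Matrix.diagonal (W t k) * G t) (castT (cubic d (lev L k * side t)) z, f) (castT (cubic d (lev L k * side t)) z', g)) atTop (𝓝 s) := by
  obtain ⟨sW, hsW⟩ := hW f z
  obtain ⟨sG, hsG⟩ := hG f g z z'
  refine ⟨sW * sG, ?_⟩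
  simp only [Matrix.diagonal_mul]
  exact hsW.mul hsG

/-- **`tendsto_couplingLetter_mul_pair`** [folklore]: EL₁ of `V₁,t`, `V₂,t`, `W_t` at level `k` and EL₂ of `G_t` ⟹ EL₂ of `A_t·G_t`, `A = P(V₁) + P(V₂)ᴴ + diag W`. -/
theorem tendsto_couplingLetter_mul_pair [∀ t, NeZero (side t)] (k : ℕ) (V₁ V₂ : (t : ℕ) → (k : ℕ) → Fin d → (idx L (cubic d (side t)) k → ℂ))
    (W : (t : ℕ) → (k : ℕ) → (idx L (cubic d (side t)) k → ℂ))
    (hV₁ : ∀ (μ f : Fin d) (z : Fin d → ℤ), ∃ s : ℂ, Tendsto (fun t => V₁ t k μ (castT (cubic d (lev L k * side t)) z, f)) atTop (𝓝 s))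
    (hV₂ : ∀ (μ f : Fin d) (z : Fin d → ℤ), ∃ s : ℂ, Tendsto (fun t => V₂ t k μ (castT (cubic d (lev L k * side t)) z, f)) atTop (𝓝 s))
    (hW : ∀ (f : Fin d) (z : Fin d → ℤ), ∃ s : ℂ, Tendsto (fun t => W t k (castT (cubic d (lev L k * side t)) z, f)) atTop (𝓝 s))
    {G : (t : ℕ) → Matrix (idx L (cubic d (side t)) k) (idx L (cubic d (side t)) k) ℂ}
    (hG : ∀ (f g : Fin d) (z z' : Fin d → ℤ), ∃ s : ℂ, Tendsto (fun t => G t (castT (cubic d (lev L k * side t)) z, f) (castT (cubic d (lev L k * side t)) z', g)) atTop (𝓝 s))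
    (f g : Fin d) (z z' : Fin d → ℤ) :
    ∃ s : ℂ, Tendsto (fun t => ((Pmodel L (cubic d (side t)) (V₁ t) k + (Pmodel L (cubic d (side t)) (V₂ t) k)ᴴ + Matrix.diagonal (W t k)) * G t)
      (castT (cubic d (lev L k * side t)) z, f) (castT (cubic d (lev L k * side t)) z', g)) atTop (𝓝 s) := by
  obtain ⟨s₁, h₁⟩ := tendsto_Pmodel_mul_pair L k V₁ hV₁ hG f g z z'
  obtain ⟨s₂, h₂⟩ := tendsto_conjTranspose_Pmodel_mul_pair L k V₂ hV₂ hG f g z z'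
  obtain ⟨s₃, h₃⟩ := tendsto_diagonal_mul_pair L k W hW hG f g z z'
  refine ⟨s₁ + s₂ + s₃, ?_⟩
  simp only [Matrix.add_mul, Matrix.add_apply]
  exact (h₁.add h₂).add h₃

end AnyVolume

/-! ## §4 `PerturbationLaws` of the coupling letter along the tower -/

section Laws

variable (M : Fin d → ℕ) [hM : ∀ μ, NeZero (M μ)] (a : ℝ) (ha : 0 < a)

/-- **`perturbationLaws_couplingLetter`** (`d ≥ 1`): for `V₁, V₂` Lipschitz backgrounds `(α, β)` and `W` a bounded background `(α′, β′)`, the family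
`k ↦ P(V₁)^{(k)} + P(V₂)^{(k)ᴴ} + diag W^{(k)}` satisfies `PerturbationLaws` w.r.t. `Δ_a`, King's pairing, `κ = 2d(α+β)Cst + α′Cst`, `e₂ k = (C2model + C2adj + Cst·β′·Cst)·L^{−k}`
(NE2's `perturbationLaws_firstOrder` + `perturbationLaws_firstOrderAdjoint` + `perturbationLaws_zerothOrder`, added). [folklore] -/
theorem perturbationLaws_couplingLetter (hd : 1 ≤ d) {V₁ V₂ : (k : ℕ) → Fin d → (idx L M k → ℂ)} {W : (k : ℕ) → (idx L M k → ℂ)} {α β α' β' : ℝ}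
    (hV₁ : LipschitzBackground L M V₁ α β) (hV₂ : LipschitzBackground L M V₂ α β) (hW : BoundedBackground L M W α' β') :
    PerturbationLaws (calDalev L M a ha) (fun k => Pmodel L M V₁ k + (Pmodel L M V₂ k)ᴴ + Matrix.diagonal (W k)) (JpcT L M)
      (2 * (d * (α + β) * Cst d a) + α' * Cst d a) (fun k => (C2model d L a α β + C2adj d L a α β + Cst d a * β' * Cst d a) * ((L : ℝ)⁻¹) ^ k) := by
  have h := perturbationLaws_add (perturbationLaws_add (perturbationLaws_firstOrder L M a ha hd hV₁) (perturbationLaws_firstOrderAdjoint L M a ha hd hV₂))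
    (perturbationLaws_zerothOrder L M a ha hW)
  refine perturbationLaws_mono h (le_of_eq (by ring)) fun k => le_of_eq ?_
  ring

end Laws

/-! ## §5 The conjugated (H-bd) letter of the coupling letter at the canonical weights -/

section Conjugated

variable (M : Fin d → ℕ) [hM : ∀ μ, NeZero (M μ)] (a : ℝ) (ha : 0 < a)

/-- **`hPc_couplingLetter` — THE CONJUGATED (H-bd) OF THE COUPLING LETTER AT THE CANONICAL WEIGHTS** [our proof]: from a conjugation-defect bound `J` of `Δ_a^{(k)}` at `ρ_{k,y}`
(`0 ≤ J < γ_D`), `‖c(A_k)·c((Δ_a^{(k)})⁻¹)‖ ≤ d·αG₂ + d·e^{|κ|}(αG₂ + β(γ_D − J)⁻¹) + α′(γ_D − J)⁻¹` for `A = P(V₁) + P(V₂)ᴴ + diag W` (`CTConjugatedHbd`'s three pieces with the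
fine-Lipschitz property of the canonical weights). -/
theorem hPc_couplingLetter {V₁ V₂ : (k : ℕ) → Fin d → (idx L M k → ℂ)} {W : (k : ℕ) → (idx L M k → ℂ)} {α β α' β' : ℝ}
    (hV₁ : LipschitzBackground L M V₁ α β) (hV₂ : LipschitzBackground L M V₂ α β) (hW : BoundedBackground L M W α' β') {κ J : ℝ} (hJ0 : 0 ≤ J)
    (hJγ : J < gamD d a) (k : ℕ) (y : idx L M 0) (hJ : ConjDefect (calDalev L M a ha k) κ (rho L M k y) J) :
    ‖conjMat κ (rho L M k y) (rho L M k y) (Pmodel L M V₁ k + (Pmodel L M V₂ k)ᴴ + Matrix.diagonal (W k)) * conjMat κ (rho L M k y) (rho L M k y) (calDalev L M a ha k)⁻¹‖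
      ≤ d * (α * G2 d a J (gamD d a - J) κ) + d * (Real.exp |κ| * (α * G2 d a J (gamD d a - J) κ + β * (gamD d a - J)⁻¹)) + α' * (gamD d a - J)⁻¹ := by
  have hℓ := fun x μ ν => abs_rho_fineStep_le L M k y x μ ν
  have h1 := opNorm_conjMat_firstOrder_le (lev L k) (one_le_lev' L k) M a ha hJ hJ0 hJγ hℓ hV₁.nonneg.1 (hV₁.bound k)
  have h2 := opNorm_conjMat_firstOrderH_le (lev L k) (one_le_lev' L k) M a ha hJ hJ0 hJγ hℓ hV₂.nonneg.1 hV₂.nonneg.2 (hV₂.bound k)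
    (fun μ i => hV₂.lipschitz k μ μ i)
  have h3 := opNorm_conjMat_diagonal_mul_inv_le (lev L k) (one_le_lev' L k) M a ha hJ hJγ hW.nonneg.1 (hW.bound k)
  rw [conjMat_add, conjMat_add, Matrix.add_mul, Matrix.add_mul]
  refine (norm_add₃_le).trans (add_le_add (add_le_add ?_ ?_) h3)
  · exact h1
  · exact h2

end Conjugated

end Summit.QuantumFields.BalabanUV.Beta.GAN24.CouplingLetterStencil

end
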